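import Literature.Computability.AlgebraicComplexity.PencilRankRegularJordanForm
import HarnessLib

/-!
# `R(⊞ⱼ 𝔍_{n_j,x} ⊞ (XI + YZ)) ≥ ∑ n_j + n' + ℓ` for an ARBITRARY `n' × n'` block `Z`
# (Sumi–Miyazaki–Sakata 2009, Thm. 14), over every field

Topic `Literature/Computability/AlgebraicComplexity` (bilinear complexity; rank of matrix pencils).
Sequel to `PencilRankJordanSumGeneral.lean` (`le_tensorRank_jordanSum`: Thm. (19.4)'s lower bound
for Jordan block sums with one eigenvalue) and `PencilRankKroneckerBlocks.lean`
(`BCS1997_lemma_19_6_1`: peeling a 1-concise diagonal block). Source: T. Sumi, M. Miyazaki,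
T. Sakata, *Rank of 3-tensors with 2 slices and Kronecker canonical forms*, LAA 431 (2009),
arXiv:0808.1167 (held text `paper:arxiv-0808.1167`, read 2026-08-27), p. 5: "Theorem 14. Let
`A_j = (E_{n_j}; xE_{n_j} + J_{n_j})` be an `n_j × n_j × 2` tensor for `j = 1, …, ℓ` and `X` an
arbitrary `n' × n'` matrix. Then `rank_𝔽(diag(A_1, …, A_ℓ, (E_{n'}; X))) ≥ ∑_{j=1}^ℓ n_j + n' + ℓ`."
(there `𝔽 = ℝ, ℂ` and the proof goes through their Thm. 11 on `2 × n × m` tensors).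

## What is proved

* **`SumiMiyazakiSakata2008_thm_14`** — the displayed inequality over EVERY field, for Jordan
  blocks of sizes `n_j ≥ 2` (for a block of size `1` the printed bound fails, e.g. `X` diagonal)
  with a common eigenvalue `x` and an arbitrary square block `X`; proof by Lemma (19.6)(1) (the
  block `(E; X)` is 1-concise) and `le_tensorRank_jordanSum`.

* `SumiMiyazakiSakata2008_thm_14_jordanMatrix` — the same with several eigenvalues: for the
  Jordan matrix `⊕ₖ 𝔍_{n_k, a_k}` plus an arbitrary block,
  `R ≥ ∑ n_k + n' + max_c #{k : a_k = c, n_k ≥ 2}` over every field (Thm. 14 combined with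
  Thm. (19.4)'s lower bound `le_tensorRank_jordanMatrix_sup`; this is the lower half of their
  Thm. 20 `rank(E_n;A) = n + max_x α(A,x)` for `A` in Jordan form up to an arbitrary direct summand).

* `SumiMiyazakiSakata2008_thm_14_eq_of_diagonalizable` — equality `= ∑ n_j + n' + ℓ` when `X` is
  diagonalizable over `K` and `|K| ≥ max n_j` (Thm. 20 for `A = (⊕ⱼ J_{n_j}(x)) ⊕ X`).

* `SumiMiyazakiSakata2008_thm_20_jordanMatrix_of_diagonalizable` — several eigenvalues: for
  `A = (⊕ₖ J_{n_k}(a_k)) ⊕ X`, `X` diagonalizable, `|K| ≥ ∑ n_k`: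
  `R = ∑ n_k + n' + max_c #{k : a_k = c, n_k ≥ 2}` = Thm. 20's `n + max_x α(A, x)` for such `A`.

Theorem-only file: no definitions, no named facts.

## References

* [SumiMiyazakiSakata2008] T. Sumi, M. Miyazaki, T. Sakata, LAA 431 (2009) 1858–1868,
  arXiv:0808.1167 — Thm. 14 (p. 5 of the arXiv text).
* [BurgisserClausenShokrollahi1997] P. Bürgisser, M. Clausen, M. A. Shokrollahi, *Algebraic
  Complexity Theory*, Springer 1997 — Lemma (19.6)(1), Thm. (19.4).
-/

noncomputable section

open scoped BigOperators
open Module Finset Matrix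

namespace Literature.Computability.AlgebraicComplexity

namespace MatrixPencil

section PartTwentyNine

universe u29

variable {K : Type u29} [Field K] {ℓ : ℕ}

/-! ### Sumi–Miyazaki–Sakata Thm. 14: Jordan blocks with one eigenvalue plus an ARBITRARY block -/

/-- **[SMS 2009, Thm. 14], over every field:** "Let `A_j = (E_{n_j}; xE_{n_j} + J_{n_j})` be an
`n_j × n_j × 2` tensor for `j = 1, …, ℓ` and `X` an arbitrary `n' × n'` matrix. Then
`rank_𝔽(diag(A_1, …, A_ℓ, (E_{n'}; X))) ≥ ∑ⱼ n_j + n' + ℓ`." (blocks of size `n_j ≥ 2`; the same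
eigenvalue `x` in all of them; NO hypothesis on `X`). Proof here: Lemma (19.6)(1)
(`BCS1997_lemma_19_6_1`: the block `(E_{n'}; X)` is 1-concise, so it can be peeled off at the cost
of exactly `n'`) and Thm. (19.4)'s lower bound for `⊞ⱼ 𝔍_{n_j, x}` (`le_tensorRank_jordanSum`).
[cite: SumiMiyazakiSakata2008, Thm. 14; BurgisserClausenShokrollahi1997, Lemma (19.6)(1) and Thm. (19.4)] -/
theorem SumiMiyazakiSakata2008_thm_14 (n : Fin ℓ → ℕ) (hn : ∀ j, 2 ≤ n j) (x : K) {n' : Type*}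
    [Fintype n'] [DecidableEq n'] (X : Matrix n' n' K) :
    ∑ j, n j + Fintype.card n' + ℓ ≤
      tensorRank (pencilTensor (1 : Matrix ((Σ j, Fin (n j)) ⊕ n') ((Σ j, Fin (n j)) ⊕ n') K)
        (fromBlocks (jordanSum n x) 0 0 X)) := by
  classical
  have h1 : LinearIndependent K (fun i => pencilTensor (1 : Matrix n' n' K) X i : n' → n' → Fin 2 → K) :=
    (BCS1997_ex_19_9_1 1 X).2 fun u hu _ => by simpa using hu
  have h := BCS1997_lemma_19_6_1 (1 : Matrix (Σ j, Fin (n j)) (Σ j, Fin (n j)) K) (jordanSum n x)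
    (0 : Matrix (Σ j, Fin (n j)) n' K) 0 (1 : Matrix n' n' K) X h1
  rw [Matrix.fromBlocks_one] at h
  have hlow := le_tensorRank_jordanSum n x (K := K)
  have hfilter : (Finset.univ.filter fun j : Fin ℓ => 2 ≤ n j).card = ℓ := by
    rw [Finset.filter_true_of_mem fun j _ => hn j, Finset.card_univ, Fintype.card_fin]
  rw [hfilter] at hlow
  omega

/-- **Thm. 14 with several eigenvalues, every field**: for `⊕ₖ 𝔍_{n_k,a_k} ⊞ (XI + YZ)` with `Z`
arbitrary, `R ≥ ∑ n_k + n' + max_c #{k : a_k = c, n_k ≥ 2}` (Lemma (19.6)(1) +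
`le_tensorRank_jordanMatrix_sup`; the lower half of `rank_𝔽(E_n;A) = n + max_x α_𝔽(A,x)`,
[SumiMiyazakiSakata2008, Thm. 20], for `A = (Jordan matrix) ⊕ Z`).
[cite: SumiMiyazakiSakata2008, Thm. 14 and Thm. 20; BurgisserClausenShokrollahi1997, Lemma (19.6)(1), Thm. (19.4)] -/
theorem SumiMiyazakiSakata2008_thm_14_jordanMatrix [DecidableEq K] (n : Fin ℓ → ℕ) (a : Fin ℓ → K)
    {n' : Type*} [Fintype n'] [DecidableEq n'] (X : Matrix n' n' K) :
    ∑ k, n k + Fintype.card n' +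
        Finset.univ.sup (fun k₀ => (Finset.univ.filter fun k => a k = a k₀ ∧ 2 ≤ n k).card) ≤
      tensorRank (pencilTensor (1 : Matrix ((Σ k, Fin (n k)) ⊕ n') ((Σ k, Fin (n k)) ⊕ n') K)
        (fromBlocks (jordanMatrix n a) 0 0 X)) := by
  classical
  have h1 : LinearIndependent K (fun i => pencilTensor (1 : Matrix n' n' K) X i : n' → n' → Fin 2 → K) :=
    (BCS1997_ex_19_9_1 1 X).2 fun u hu _ => by simpa using hu
  have h := BCS1997_lemma_19_6_1 (1 : Matrix (Σ k, Fin (n k)) (Σ k, Fin (n k)) K) (jordanMatrix n a)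
    (0 : Matrix (Σ k, Fin (n k)) n' K) 0 (1 : Matrix n' n' K) X h1
  rw [Matrix.fromBlocks_one] at h
  have hlow := le_tensorRank_jordanMatrix_sup n a (K := K)
  omega

/-- **Equality when the extra block is diagonalizable** (and `|K| ≥ max n_j`): for
`X = P⁻¹·diag·P` (criterion (14.45)(2)), `R(XI + Y(⊕ⱼ 𝔍_{n_j,x} ⊕ X)) = ∑ n_j + n' + ℓ` — the
lower bound of Thm. 14 with the upper bound (19.6)(2) + Thm. (19.4) + `R(XI + YX) = n'`; this is
[SumiMiyazakiSakata2008, Thm. 20] `rank(E_n;A) = n + max_x α(A,x)` for `A = (⊕ⱼ J_{n_j}(x)) ⊕ X`.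
[cite: SumiMiyazakiSakata2008, Thm. 14 and Thm. 20; BurgisserClausenShokrollahi1997, Lemma (19.6)(2), Thm. (19.4), Prop. (14.45)(2)] -/
theorem SumiMiyazakiSakata2008_thm_14_eq_of_diagonalizable (n : Fin ℓ → ℕ) (hn : ∀ j, 2 ≤ n j)
    (hK : ∀ j, ∃ α : Fin (n j) → K, Function.Injective α) (x : K) {n' : Type*} [Fintype n']
    [DecidableEq n'] (X : Matrix n' n' K)
    (hX : ∃ (P : Matrix n' n' K) (d : n' → K), IsUnit P.det ∧ P * X = diagonal d * P) :
    tensorRank (pencilTensor (1 : Matrix ((Σ j, Fin (n j)) ⊕ n') ((Σ j, Fin (n j)) ⊕ n') K)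
        (fromBlocks (jordanSum n x) 0 0 X)) = ∑ j, n j + Fintype.card n' + ℓ := by
  classical
  refine le_antisymm ?_ (SumiMiyazakiSakata2008_thm_14 n hn x X)
  have h := BCS1997_lemma_19_6_2 (1 : Matrix (Σ j, Fin (n j)) (Σ j, Fin (n j)) K) (jordanSum n x)
    (1 : Matrix n' n' K) X
  rw [Matrix.fromBlocks_one] at h
  have hJ := BCS1997_thm_19_4_jordanSum n x hK
  have hfilter : (Finset.univ.filter fun j : Fin ℓ => 2 ≤ n j).card = ℓ := by
    rw [Finset.filter_true_of_mem fun j _ => hn j, Finset.card_univ, Fintype.card_fin]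
  rw [hfilter] at hJ
  have hXr := (tensorRank_pencilTensor_one_le_card_iff X).2 hX
  omega

/-- **[SMS 2009, Thm. 20] `rank(E_n; A) = n + max_x α(A, x)` for `A = (⊕ₖ J_{n_k}(a_k)) ⊕ X` with
`X` diagonalizable over `K`** (`|K| ≥ ∑ n_k`): the Jordan matrix with several eigenvalues plus a
diagonalizable block has pencil rank `∑ n_k + n' + max_c #{k : a_k = c, n_k ≥ 2}` exactly
(`SumiMiyazakiSakata2008_thm_14_jordanMatrix` with the upper bound (19.6)(2) + Thm. (19.4) for
regular pencils `tensorRank_jordanMatrix_le_sup` + `R(XI + YX) = n'`). ("Theorem 20. Let `A` be an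
`n×n` matrix and let `α_𝔽(A,x)` be the number of Jordan blocks whose sizes are greater than or equal
to `2` for an eigenvalue `x` of `A`. Then `rank_𝔽(E_n;A) = n + max_x α_𝔽(A,x)`" — there for
`𝔽 = ℝ, ℂ` and arbitrary `A` via its (real) Jordan form; here for `A` GIVEN as Jordan ⊕ diagonalizable.)
[cite: SumiMiyazakiSakata2008, Thm. 20 and Thm. 14; BurgisserClausenShokrollahi1997, Thm. (19.4), Lemma (19.6)(1)(2), Prop. (14.45)(2)] -/
theorem SumiMiyazakiSakata2008_thm_20_jordanMatrix_of_diagonalizable [DecidableEq K] (n : Fin ℓ → ℕ)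
    (a : Fin ℓ → K) (α : Fin (∑ k, n k) → K) (hα : Function.Injective α) {n' : Type*} [Fintype n']
    [DecidableEq n'] (X : Matrix n' n' K)
    (hX : ∃ (P : Matrix n' n' K) (d : n' → K), IsUnit P.det ∧ P * X = diagonal d * P) :
    tensorRank (pencilTensor (1 : Matrix ((Σ k, Fin (n k)) ⊕ n') ((Σ k, Fin (n k)) ⊕ n') K)
        (fromBlocks (jordanMatrix n a) 0 0 X)) =
      ∑ k, n k + Fintype.card n' +
        Finset.univ.sup (fun k₀ => (Finset.univ.filter fun k => a k = a k₀ ∧ 2 ≤ n k).card) := by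
  classical
  refine le_antisymm ?_ (SumiMiyazakiSakata2008_thm_14_jordanMatrix n a X)
  have h := BCS1997_lemma_19_6_2 (1 : Matrix (Σ k, Fin (n k)) (Σ k, Fin (n k)) K) (jordanMatrix n a)
    (1 : Matrix n' n' K) X
  rw [Matrix.fromBlocks_one] at h
  have hJ := tensorRank_jordanMatrix_le_sup n a α hα
  have hXr := (tensorRank_pencilTensor_one_le_card_iff X).2 hX
  omega

end PartTwentyNine

end MatrixPencil

end Literature.Computability.AlgebraicComplexity

end
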